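/-
Copyright (c) 2026 the pub-hodgecm-mathlib formalisation cell (harness21).  Prover seat hodgecm-mathlib-K2Liu-p14 (g2), Track B «K2-LIT»,
#184♮ = hLiu418 = `stmt-HodgeConjecture-24832`; socket #42S organ S2 («ARCH SPAN BY K-TYPE PATHS»), S2-W ∕ S2-asm Weil-side datum for LEAD F0P6-plan (g14) OWNER WORD σ15
(«`hS2arch` DELIVERS K_∞-FINITE REALISERS: `V_d := 𝒫_{≤d}·Gauss_σ` finite-dimensional and `K`-stable», 12:40:33Z; K2Liu-p03 (g7) 12:40:19Z).
-/
import Summits.HodgeConjecture.HodgeConjecture.Theorems.K2LiuWeilDatumFockStabilityU22     -- ★ (G2-W3 (i)) `κOp_binvPi`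
import Literature.Analysis.SegalBargmann.FockInfinitesimalAction                           -- ★ `totalDegree_linSubst_le`
import HarnessLib

/-!
# Crux `HLiu418`, organ S2 (σ15 Weil side): THE DEGREE FILTRATION `V_d = B⁻¹(𝒫_{≤d}) = 𝒫_{≤d}·Gauss` OF THE JUNCTION SCHWARTZ SPACE IS FINITE-DIMENSIONAL AND STABLE
# UNDER THE WHOLE COMPACT GROUP `K × K′` OF THE DUAL PAIR — the finite-dimensional `K`-stable realiser datum `(V_d, Φ ∈ V_d)` that `hS2arch` must deliver

Cell `hodgecm-mathlib`, crux item hLiu418 = `stmt-HodgeConjecture-24832`; squad K2 ∕ K2Liu; prover K2Liu-p14 (g2).  THEOREMS ONLY (no `def`, no instance, no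
notation, no named-fact hypothesis, no `sorry`); lane `--supports stmt-HodgeConjecture-24832 --as helper`.  Junction Weil datum of `U(2,2) × U(R,S)` on
`𝓢(DPIdx (Fin 2) (Fin 2) R S → ℝ, ℂ)`, index-generic `R S`; the filtration is written INLINE as `(MvPolynomial.restrictTotalDegree _ ℂ d).map binvPiₗ` (no def).

WHY (σ15).  `ArchSWSpanning` concludes with REALISERS `(sB i, Y i, Φ i, V i)`, `V i` finite-dimensional, stable under the arch part of the compact group, `Φ i ∈ V i` — never a
`K`-isotypic projection on `𝓢`.  S2-asm's realisers are `Φ ∈ 𝒫_{≤d}·Gauss_σ`; this file is the Weil-side half of «S2-asm pays σ15 for free»: `V_d := B⁻¹(𝒫_{≤d})` is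
finite-dimensional (`finiteDimensional_fockLe`), monotone in `d`, contains `B⁻¹F` for `deg F ≤ d` and the Gaussian `h₀` for every `d` (`hermitePi_zero_mem_fockLe`), and is STABLE
under every frame operator `κOp e k`, `k ∈ K × K′` (`κOp_mem_fockLe`: ★ `κOp_binvPi` = Bargmann substitution by a unitary matrix, ★ `totalDegree_linSubst_le`), hence under
`ω(κ k)` for every archimedean Weil datum with the vacuum clause (`weilDatum_κ_mem_fockLe`, ★ `weilDatum_apply_κ_eq_κOp`); packaged: **`exists_finiteDimensional_kStable_mem`**.
The transport of `(V_d, h₀)` to S2-D's `IsArchDatum`∕(S4-Kfin) `harch` letters on `𝓢(Fin (n′+n′) → mixedSpace)` is S2-J ∕ S2-⊗ 2c (K2Liu-p05, K2Liu-p11) BY NAME.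
References: [Folland1989, §1.7, Prop. (4.39)]; [KonnoKonno2007, §3.3, Lemma 5.2]; [Howe1989, §3 (K-finite = polynomial × Gaussian)].
HONEST LABEL.  Count-neutral helper: `HC_CM` is proved only modulo the 7 printed citations (2 remaining named inputs: hLiu418 = `stmt-HodgeConjecture-24832`,
h413 = `stmt-HodgeConjecture-24833`) until rung 0 closes.
-/

set_option autoImplicit false
set_option linter.dupNamespace false -- the mandated namespace repeats `HodgeConjecture.HodgeConjecture`

noncomputable section

open scoped MatrixGroups Matrix Topology SchwartzMap ComplexConjugate
open Filter Complex MvPolynomial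
open Literature.NumberTheory.Automorphic Literature.Analysis.SegalBargmann Literature.NumberTheory.Weil1964
open Literature.RepresentationTheory.KonnoKonno2007 hiding LetterKind letterOf letterGen letterOf_boost letterOf_torus letterOf_torus_eq
  letterGen_boost letterGen_torus letterGen_mem_lie exp_smul_letterGen
open Literature.RepresentationTheory.KonnoKonno2007.RealDualPair
open Literature.RepresentationTheory.KonnoKonno2007.RealDualPair.UForm
open Summit.HodgeConjecture.HodgeConjecture.Cruxes.HLiu418.K2LiuWeilDatumSmoothU22

namespace Summit.HodgeConjecture.HodgeConjecture.Cruxes.HLiu418.K2LiuArchWeilFockFiniteDatum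

section Generic

variable {σ : Type*} [Fintype σ] [DecidableEq σ]

/-- membership in the degree filtration `V_d = B⁻¹(𝒫_{≤d})`: `Φ ∈ V_d ↔ ∃ F, deg F ≤ d ∧ B⁻¹F = Φ`. [folklore] -/
theorem mem_fockLe_iff (d : ℕ) (Φ : SchwartzMap (σ → ℝ) ℂ) :
    Φ ∈ (MvPolynomial.restrictTotalDegree σ ℂ d).map (binvPiₗ : MvPolynomial σ ℂ →ₗ[ℂ] SchwartzMap (σ → ℝ) ℂ) ↔
      ∃ F : MvPolynomial σ ℂ, F.totalDegree ≤ d ∧ binvPi F = Φ := by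
  simp only [Submodule.mem_map, MvPolynomial.mem_restrictTotalDegree, binvPiₗ_apply]

/-- **`V_d` IS FINITE-DIMENSIONAL** (image of the finite-dimensional `𝒫_{≤d}`). [folklore] -/
theorem finiteDimensional_fockLe (d : ℕ) :
    FiniteDimensional ℂ ↥((MvPolynomial.restrictTotalDegree σ ℂ d).map (binvPiₗ : MvPolynomial σ ℂ →ₗ[ℂ] SchwartzMap (σ → ℝ) ℂ)) :=
  inferInstance

/-- the filtration is monotone in `d`. [folklore] -/
theorem fockLe_mono {d d' : ℕ} (h : d ≤ d') :
    (MvPolynomial.restrictTotalDegree σ ℂ d).map (binvPiₗ : MvPolynomial σ ℂ →ₗ[ℂ] SchwartzMap (σ → ℝ) ℂ) ≤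
      (MvPolynomial.restrictTotalDegree σ ℂ d').map (binvPiₗ : MvPolynomial σ ℂ →ₗ[ℂ] SchwartzMap (σ → ℝ) ℂ) :=
  Submodule.map_mono fun _ hF => (MvPolynomial.mem_restrictTotalDegree _ _ _).2 (((MvPolynomial.mem_restrictTotalDegree _ _ _).1 hF).trans h)

/-- `B⁻¹F ∈ V_d` for `deg F ≤ d`. [folklore] -/
theorem binvPi_mem_fockLe {d : ℕ} {F : MvPolynomial σ ℂ} (hF : F.totalDegree ≤ d) :
    binvPi F ∈ (MvPolynomial.restrictTotalDegree σ ℂ d).map (binvPiₗ : MvPolynomial σ ℂ →ₗ[ℂ] SchwartzMap (σ → ℝ) ℂ) :=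
  (mem_fockLe_iff d _).2 ⟨F, hF, rfl⟩

/-- **THE GAUSSIAN LIES IN EVERY `V_d`**: `h₀ = B⁻¹ζ₀ ∈ V_0 ⊆ V_d`. [cite: Folland1989, §1.7] -/
theorem hermitePi_zero_mem_fockLe (d : ℕ) :
    (hermitePi 0 : SchwartzMap (σ → ℝ) ℂ) ∈ (MvPolynomial.restrictTotalDegree σ ℂ d).map (binvPiₗ : MvPolynomial σ ℂ →ₗ[ℂ] SchwartzMap (σ → ℝ) ℂ) := by
  rw [← binvPi_zeta]
  refine binvPi_mem_fockLe ((MvPolynomial.totalDegree_smul_le _ _).trans ?_)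
  rw [MvPolynomial.monomial_zero', MvPolynomial.totalDegree_C]
  exact Nat.zero_le _

end Generic

variable {R S : Type*} [Fintype R] [DecidableEq R] [Fintype S] [DecidableEq S]

/-- **`V_d` IS STABLE UNDER EVERY FRAME OPERATOR `κOp e k`, `k ∈ K × K′`** (★ `κOp_binvPi`: a vacuum scalar times a Bargmann substitution by a unitary matrix, which does
not raise the total degree, ★ `totalDegree_linSubst_le`). [cite: Folland1989, Prop. (4.39)] -/
theorem κOp_mem_fockLe (e : VacExponents) (k : DPK (Fin 2) (Fin 2) R S) {d : ℕ} {Φ : SchwartzMap (DPIdx (Fin 2) (Fin 2) R S → ℝ) ℂ}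
    (hΦ : Φ ∈ (MvPolynomial.restrictTotalDegree (DPIdx (Fin 2) (Fin 2) R S) ℂ d).map
      (binvPiₗ : MvPolynomial (DPIdx (Fin 2) (Fin 2) R S) ℂ →ₗ[ℂ] SchwartzMap (DPIdx (Fin 2) (Fin 2) R S → ℝ) ℂ)) :
    κOp R S e k Φ ∈ (MvPolynomial.restrictTotalDegree (DPIdx (Fin 2) (Fin 2) R S) ℂ d).map
      (binvPiₗ : MvPolynomial (DPIdx (Fin 2) (Fin 2) R S) ℂ →ₗ[ℂ] SchwartzMap (DPIdx (Fin 2) (Fin 2) R S → ℝ) ℂ) := by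
  obtain ⟨F, hF, rfl⟩ := (mem_fockLe_iff d Φ).1 hΦ
  rw [κOp_binvPi]
  exact binvPi_mem_fockLe (((MvPolynomial.totalDegree_smul_le _ _).trans (totalDegree_linSubst_le _ _)).trans hF)

/-- **… HENCE UNDER `ω(κ k)` FOR EVERY ARCHIMEDEAN WEIL DATUM WITH THE VACUUM CLAUSE** (★ `weilDatum_apply_κ_eq_κOp`): the compact group `K × K′` of the dual pair preserves
`V_d`. [cite: Folland1989, Prop. (4.39)] [cite: KonnoKonno2007, Lemma 5.2] -/
theorem weilDatum_κ_mem_fockLe {ω : Representation ℂ (Ginf (Fin 2) (Fin 2) R S) (SchwartzMap (DPIdx (Fin 2) (Fin 2) R S → ℝ) ℂ)}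
    (hW : IsArchWeilDatum (ι𝕎 (Fin 2) (Fin 2) R S) ω) {e : VacExponents}
    (hvac : ∀ k : DPK (Fin 2) (Fin 2) R S, ω (κ (Fin 2) (Fin 2) R S k) (hermitePi 0) = vacScalar e k • hermitePi 0)
    (k : DPK (Fin 2) (Fin 2) R S) {d : ℕ} {Φ : SchwartzMap (DPIdx (Fin 2) (Fin 2) R S → ℝ) ℂ}
    (hΦ : Φ ∈ (MvPolynomial.restrictTotalDegree (DPIdx (Fin 2) (Fin 2) R S) ℂ d).map
      (binvPiₗ : MvPolynomial (DPIdx (Fin 2) (Fin 2) R S) ℂ →ₗ[ℂ] SchwartzMap (DPIdx (Fin 2) (Fin 2) R S → ℝ) ℂ)) :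
    ω (κ (Fin 2) (Fin 2) R S k) Φ ∈ (MvPolynomial.restrictTotalDegree (DPIdx (Fin 2) (Fin 2) R S) ℂ d).map
      (binvPiₗ : MvPolynomial (DPIdx (Fin 2) (Fin 2) R S) ℂ →ₗ[ℂ] SchwartzMap (DPIdx (Fin 2) (Fin 2) R S → ℝ) ℂ) := by
  rw [weilDatum_apply_κ_eq_κOp hW hvac k Φ]
  exact κOp_mem_fockLe e k hΦ

/-- **σ15 ON THE WEIL SIDE — THE FINITE-DIMENSIONAL `K`-STABLE REALISER DATUM**: for every archimedean Weil datum `ω` of `U(2,2) × U(R,S)` with the vacuum clause and every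
Fock polynomial `F`, there is a finite-dimensional subspace `V ∋ B⁻¹F` of the Schwartz space (namely `V_{deg F}`) stable under `ω(κ k)` for all `k ∈ K × K′` and containing
the Gaussian `h₀`. [cite: Folland1989, Prop. (4.39)] [cite: Howe1989, §3] -/
theorem exists_finiteDimensional_kStable_mem {ω : Representation ℂ (Ginf (Fin 2) (Fin 2) R S) (SchwartzMap (DPIdx (Fin 2) (Fin 2) R S → ℝ) ℂ)}
    (hW : IsArchWeilDatum (ι𝕎 (Fin 2) (Fin 2) R S) ω) {e : VacExponents}
    (hvac : ∀ k : DPK (Fin 2) (Fin 2) R S, ω (κ (Fin 2) (Fin 2) R S k) (hermitePi 0) = vacScalar e k • hermitePi 0)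
    (F : MvPolynomial (DPIdx (Fin 2) (Fin 2) R S) ℂ) :
    ∃ V : Submodule ℂ (SchwartzMap (DPIdx (Fin 2) (Fin 2) R S → ℝ) ℂ), FiniteDimensional ℂ V ∧
      (∀ k : DPK (Fin 2) (Fin 2) R S, ∀ Φ ∈ V, ω (κ (Fin 2) (Fin 2) R S k) Φ ∈ V) ∧ binvPi F ∈ V ∧ (hermitePi 0 : SchwartzMap _ ℂ) ∈ V :=
  ⟨_, finiteDimensional_fockLe F.totalDegree, fun k _ hΦ => weilDatum_κ_mem_fockLe hW hvac k hΦ, binvPi_mem_fockLe le_rfl, hermitePi_zero_mem_fockLe _⟩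

end Summit.HodgeConjecture.HodgeConjecture.Cruxes.HLiu418.K2LiuArchWeilFockFiniteDatum

end
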